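import Literature.Topology.FourManifolds.LinkGaussDiagrams
import Mathlib.GroupTheory.Perm.Cycle.Basic
import Mathlib.Data.ZMod.Basic
import HarnessLib

/-!
# DESIGN SKETCH (crux workfile, not a library file): realisability of link Gauss diagrams

Crux `ZseThesis` (stmt-SmoothPoincare4-0364), link tower: the realisability layer announced in the
headers of `LinkGaussDiagrams` and `LinkKhResolutions`. The knot tower reads the Gauss
diagram of a smooth knot through `Knot.RegularProjection K` / `Knot.HasGaussDiagram K G`
(`GaussDiagrams.lean`): a diagram, strictly increasing parameters `θ` of the `2n` passages within one
period, and six geometric clauses on the stereographic plane curve `K.planeCurve` (pole avoidance,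
immersion, `double`, `eq_or_crossing`, `heightCurve_lt`, `sign_eq`). This file proposes the link
analogue for the recently landed `LinkGaussDiagram` (`LinkGaussDiagrams.lean`: knot-style chord data +
traversal successor `next : Equiv.Perm (Fin (2n))` + `free` chord-free circles):
`LinkRegularProjection L` for `L : Link ι` and `Link.HasGaussDiagram L D`. Everything below elaborates
(no `sorry`, no named fact); it is meant to be copied, after review, into
`Literature/Topology/FourManifolds/LinkGaussDiagramsRealisation.lean` by a definition seat.

## The proposal in one paragraph

`LinkRegularProjection L` = a diagram `D`; `comp : Fin (2 * D.n) → ι` (the component carrying each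
marked point) and `θ : Fin (2 * D.n) → ℝ` (its parameter there), forming a **traversal order** for
`D.next` (`IsTraversalOrder`: `comp` is `next`-invariant; along `next` the parameter increases except
at AT MOST ONE *wrap point* per component, whose successor is the component's base point; the
parameters of one component lie in an open window of length `2π`); an embedding
`freeComp : Fin D.free ↪ ι` onto the components carrying no marked point; and the knot clauses
indexed by components: pole avoidance and immersion for every component, `double`, ONE clause
`eq_or_crossing` on `ι × ℝ` (any coincidence `γ_a s = γ_b t` is `a = b ∧ s ≡ t (mod 2π)` or, up to
`2π`-shifts, the pair of passages of a chord — covering self-crossings, mutual crossings, embeddedness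
of free components and their disjointness from everything else: `exists_int_of_free`,
`planeCurve_ne_of_free`), `heightCurve_lt`, `sign_eq`. `Link.HasGaussDiagram L D := ∃ P, P.diagram = D`.

## Design choices (and rejected alternatives)

* **`next`, not block-contiguous numbering.** One could insist that component number `k` owns the
  block `[m_k, m_{k+1})` numbered increasingly in `θ` (`next` = "add one inside each block").
  Rejected: `LinkGaussDiagram` lets `next` be any permutation — the saddle `next ↦ next * swap p q`
  and the chord insertions of Reidemeister moves destroy contiguity, and realisability must be
  provable for the diagrams these moves produce without an intervening relabelling. So the
  structure reads an ARBITRARY `next`, and "increasing parameter" is phrased along `next`-cycles.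
* **How "θ increases along `next`" is phrased.** `IsTraversalOrder.wrap_unique`: in each fibre of
  `comp` there is at most one `p` with `θ (next p) ≤ θ p`; and `lt_add_two_pi`: `θ p < θ q + 2π`
  within a fibre. Existence of a wrap point on every cycle is automatic (the increments around a
  finite cycle sum to zero, `exists_wrap`), hence: every fibre of `comp` is ONE cycle of `next`
  (`sameCycle_iff` — so "one cycle per component" need not be a field), the base point of a
  component is `next d` for its wrap point `d`, and from the base the parameters read
  `θ b < θ (next b) < ⋯ < θ d < θ b + 2π` (`lt_of_wrap`, `strictMono_of_wrap`), i.e. exactly the knot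
  picture `strictMono`/`lt_add_two_pi` re-based; the knot tower's clauses are the case
  `next = finRotate`, wrap point `2n - 1` (`LinkRegularProjection.ofKnot`). Rejected: (a) base
  points as data (`base : ι → Option (Fin 2n)` or a `Finset` with one point per cycle) — redundant
  data that every consumer would have to carry through moves; (b) a rank function `Fin (2n) → ℕ`
  along cycles — same objection, and it duplicates `Equiv.Perm.SameCycle.exists_pow_eq'`; (c) the
  strict variant "exactly one descent `θ (next p) < θ p` and no stationary step" — equivalent on
  realisable data, one clause more; (d) conditions on `circlePoint ∘ θ` — would need a cyclic-order
  API tied to `circlePoint`, whereas two real inequalities are what `RegularProjectionParity`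
  consumes. The window condition is per component (not global, as it could be after normalising all
  `θ` into `[0, 2π)`), so that each component may be re-based independently.
* **`comp` is data.** The cycles of `next` only give the partition of the marked points; `comp`
  names the component of `L` (an element of `ι`) that carries each cycle, and the geometric clauses
  cannot even be stated without it (which curve is evaluated at `θ p`?). Deriving it would mean
  indexing the link by `cycles ⊕ Fin free`, i.e. carrying an equivalence `ι ≃ _` instead — heavier,
  and that equivalence is `comp` + `freeComp` anyway.
* **Free components** are matched by an embedding `freeComp : Fin D.free ↪ ι` with
  `range freeComp = (range comp)ᶜ`: this makes `D.Arc = Fin (2n) ⊕ Fin free` correspond canonically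
  to the geometric arcs (`inl p ↦` the arc of `comp p` from `θ p` to its successor, `inr j ↦` the whole
  circle `freeComp j`), which the cobordism maps of births/deaths will need. Rejected: the mere
  equation `free + #(range comp) = #ι` (no canonical arc correspondence). Consequence: `ι` is finite
  (`finite_index`), so NO `[Fintype ι]` argument is taken.
* **The `n = 0` caveat.** `LinkGaussDiagram.ofGaussDiagram G` has `free = 0` even when `G.n = 0`,
  but a crossingless knot projection is one FREE circle: its honest link diagram is `unknots 1`
  (cf. `ofGaussDiagram_empty`, and the caveat of `LinkKhResolutions`). Hence the corrected embedding
  `ofKnotDiagram G` (`free := if G.n = 0 then 1 else 0`), equal to `ofGaussDiagram G` for `G.n ≠ 0`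
  and to `unknots 1` for `G.n = 0`, and the sanity theorem `hasGaussDiagram_ofKnot`:
  `K.HasGaussDiagram G → Link.HasGaussDiagram (Link.ofKnot K) (ofKnotDiagram G)` — every clause of
  the link structure specialises to (and is derived from) the corresponding knot clause.
* `eq_or_crossing` keeps the knot tower's "unordered pair up to shifts" form, now in `Set (ι × ℝ)`;
  consumers convert with `Set.pair_eq_pair_iff`. `sign_eq` keeps `Matrix.det` (not `cross` of
  `GaussDiagramsPerturbation`) so that the knot clause is reused literally.

## What the next file (merge-or-split for realisable link diagrams, `d² = 0`) needs

The knot tower derives the dichotomy from Gauss's parity condition through a 2-colouring of the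
marked points that flips along an arc (`p ↦ p ± 1`) and across a chord (`KhResolutionsDichotomyProofs`,
`succPt_val_mod_two`, Gauss evenness). The link version of that input is a **checkerboard colouring**
`IsCheckerboard D c`: `c (next p) = c p + 1` and `c (underPos i) = c (overPos i) + 1` in `ZMod 2`
(equivalently: after crossing changes the diagram is alternating — colour a passage by "over";
the checkerboard colourability of Kamada (2002) for virtual diagrams; on `ofGaussDiagram G` position
parity is one iff all chords of `G` are even, `isCheckerboard_ofGaussDiagram`; it forces every
component to carry an even number of chord ends, `IsCheckerboard.even_minimalPeriod`). The
realisability theorem to prove there is `∀ P : LinkRegularProjection L, ∃ c, IsCheckerboard P.diagram c`,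
with `c p :=` parity of `∑_a wind (γ_a, x_p)` for a point `x_p` just to the right of the arc leaving
passage `p`: the clauses supply continuity and differentiability of every `γ_a` (`northPole_notMem`,
`deriv_ne_zero`), that `x_p` can be moved along the arc without meeting any curve (`eq_or_crossing`),
and the jump `±1` when crossing the transverse strand at the next passage (`det_ne_zero`) — the
winding-number engine of `RegularProjectionParity` applies verbatim, free components contributing
constants. Evenness of the number of mutual crossings of two components `a ≠ b` (integrality of the
linking number) is a separate consequence of the same engine (`t ↦ wind (γ_a, γ_b t)` is periodic
and jumps `±1` exactly at the mutual chords) and is NOT implied by checkerboard colourability of the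
abstract diagram (three circles pairwise crossing once virtually are checkerboard colourable).

## Open questions left to the definition seat

1. *Base points.* The link structure fixes no base point, so on `Link.ofKnot K` it is slightly more
   permissive than `Knot.RegularProjection` (any rotation of the numbering is a traversal order for
   `finRotate`); the expected converse of `hasGaussDiagram_ofKnot` is
   `Link.HasGaussDiagram (ofKnot K) (ofKnotDiagram G) → ∃ k, K.HasGaussDiagram (G.rotate k)`
   (re-base at the successor of the wrap point; needs `GaussDiagram.rotate` bookkeeping only).
2. *Relabelling.* Readings of one projection differ by chord renumbering and a relabelling `τ` of the
   marked points with `next' = τ * next * τ⁻¹`; `LinkGaussDiagram.IsRelabelling` does not exist yet,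
   and `Link.HasGaussDiagram` is (deliberately, as for knots) not closed under it by definition.
3. *Named facts to vendor* (D-0014 style, in the library copy, not here):
   `Link.exists_hasGaussDiagram_of_isIsotopic` (generic projections: the knot perturbation argument
   component by component plus mutual transversality) and the checkerboard theorem above.
4. *Symmetries.* Reversing ONE component `a` inverts `next` on the fibre of `a`, keeps
   `overPos/underPos`, keeps the signs of the self-chords of `a` and NEGATES the signs of its mutual
   chords (one strand of each such crossing is reversed); the mirror swaps `overPos/underPos` and
   negates all signs, as for knots.

## References

* M. Goussarov, M. Polyak, O. Viro, *Finite-type invariants of classical and virtual knots*,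
  Topology 39 (2000), §1 (Gauss diagrams of links: one circle per component). [cite: GPV2000, §1]
* D. Rolfsen, *Knots and Links* (1976), §3.E (regular projections). [cite: Rolfsen1976, §3.E]
* N. Kamada, *On the Jones polynomials of checkerboard colorable virtual links*, Osaka J. Math. 39
  (2002) 325–333 (checkerboard colourable diagrams; classical link diagrams are). [cite: Kamada2002]
* L. H. Kauffman, *Virtual knot theory*, European J. Combin. 20 (1999), §3.2, Lemma 1 (planar Gauss
  codes are evenly intersticed). [cite: Kauffman1999, §3.2 Lemma 1]
* O. Viro, *Khovanov homology, its definitions and ramifications*, Fund. Math. 184 (2004), §5.2.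
-/

noncomputable section

-- the prescribed namespace `Summit.<P>.<Sub>.…` duplicates `SmoothPoincare4`
set_option linter.dupNamespace false

open Function Set

namespace Summit.SmoothPoincare4.SmoothPoincare4.Cruxes.ZseThesis.Design

open Literature.Topology.FourManifolds

/-! ## 1. Traversal orders: "θ increases along `next`, one wrap per component" -/

/-- **Traversal order.** For a successor permutation `next` of `m` marked points, a component
assignment `comp` and parameters `θ`: `comp` is constant along `next`; in each fibre of `comp` at
most one point `p` is a *wrap point*, `θ (next p) ≤ θ p` (everywhere else `θ` strictly increases along
`next`); and the parameters of one fibre lie in an open window of length `2π`. On `next = finRotate`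
with a constant `comp`, the knot tower's `StrictMono θ ∧ ∀ i j, θ i < θ j + 2π` is the special case
with wrap point `2n - 1` (base point `0`); a general traversal order for `finRotate` is a rotated
reading. [folklore] -/
structure IsTraversalOrder {m : ℕ} {ι : Type*} (next : Equiv.Perm (Fin m)) (comp : Fin m → ι)
    (θ : Fin m → ℝ) : Prop where
  /-- Successive marked points lie on the same component. -/
  comp_next : ∀ p, comp (next p) = comp p
  /-- At most one wrap point per component: elsewhere the parameter increases along `next`. -/
  wrap_unique : ∀ p q, comp p = comp q → θ (next p) ≤ θ p → θ (next q) ≤ θ q → p = q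
  /-- The parameters of one component lie in one period. -/
  lt_add_two_pi : ∀ p q, comp p = comp q → θ p < θ q + 2 * Real.pi

namespace IsTraversalOrder

variable {m : ℕ} {ι : Type*} {next : Equiv.Perm (Fin m)} {comp : Fin m → ι} {θ : Fin m → ℝ}

/-- **Every cycle has a wrap point** (pure combinatorics of a finite cycle, no hypothesis: the
increments of `θ` around a cycle cannot all be positive). [folklore] -/
theorem exists_wrap (next : Equiv.Perm (Fin m)) (θ : Fin m → ℝ) (p : Fin m) :
    ∃ d, next.SameCycle p d ∧ θ (next d) ≤ θ d := by
  by_contra hno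
  push Not at hno
  have hlt : ∀ k, θ p < θ ((next ^ (k + 1)) p) := by
    intro k
    induction k with
    | zero => simpa using hno p (Equiv.Perm.SameCycle.refl _ _)
    | succ k ih =>
      refine ih.trans ?_
      rw [pow_succ' next (k + 1), Equiv.Perm.mul_apply]
      exact hno _ (Equiv.Perm.sameCycle_pow_right.2 (Equiv.Perm.SameCycle.refl _ _))
  obtain ⟨k, hk⟩ : ∃ k, orderOf next = k + 1 :=
    Nat.exists_eq_add_one_of_ne_zero (orderOf_pos next).ne'
  have := hlt k
  rw [← hk, pow_orderOf_eq_one, Equiv.Perm.one_apply] at this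
  exact lt_irrefl _ this

variable (h : IsTraversalOrder next comp θ)
include h

/-- `comp` is constant along iterates of `next`. [folklore] -/
theorem comp_pow (p : Fin m) (k : ℕ) : comp ((next ^ k) p) = comp p := by
  induction k with
  | zero => rfl
  | succ k ih => rw [pow_succ', Equiv.Perm.mul_apply, h.comp_next, ih]

/-- Points on one cycle of `next` lie on one component. [folklore] -/
theorem comp_eq_of_sameCycle {p q : Fin m} (hpq : next.SameCycle p q) : comp p = comp q := by
  obtain ⟨k, -, rfl⟩ := hpq.exists_pow_eq'
  exact (h.comp_pow p k).symm

/-- **One cycle per component**: a fibre of `comp` is a single cycle of `next` (two cycles would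
carry two wrap points). [folklore] -/
theorem sameCycle_of_comp_eq {p q : Fin m} (hpq : comp p = comp q) : next.SameCycle p q := by
  obtain ⟨d, hd, hdθ⟩ := exists_wrap next θ p
  obtain ⟨e, he, heθ⟩ := exists_wrap next θ q
  have hde : d = e := h.wrap_unique d e
    (by rw [← h.comp_eq_of_sameCycle hd, ← h.comp_eq_of_sameCycle he, hpq]) hdθ heθ
  subst hde
  exact hd.trans he.symm

/-- The components met by chords are exactly the cycles of `next`. [folklore] -/
theorem sameCycle_iff {p q : Fin m} : next.SameCycle p q ↔ comp p = comp q :=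
  ⟨h.comp_eq_of_sameCycle, h.sameCycle_of_comp_eq⟩

/-- **Increase from the base point.** If `d` is a wrap point, then walking from the base point
`next d` the parameter increases at every step that has not yet returned to the base. [folklore] -/
theorem lt_of_wrap {d : Fin m} (hd : θ (next d) ≤ θ d) (k : ℕ)
    (hk : (next ^ (k + 1)) (next d) ≠ next d) :
    θ ((next ^ k) (next d)) < θ ((next ^ (k + 1)) (next d)) := by
  by_contra hle
  push Not at hle
  rw [pow_succ', Equiv.Perm.mul_apply] at hle hk
  have hx : (next ^ k) (next d) = d :=
    h.wrap_unique _ d (by rw [h.comp_pow, h.comp_next]) hle hd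
  exact hk (by rw [hx])

/-- The knot picture re-based: `θ b < θ (next b) < ⋯` along the first `k` steps from the base point
`b = next d`, as long as they do not return to `b` (with `lt_add_two_pi`: all within `θ b + 2π`).
[folklore] -/
theorem strictMono_of_wrap {d : Fin m} (hd : θ (next d) ≤ θ d) {k : ℕ}
    (hk : ∀ j < k, (next ^ (j + 1)) (next d) ≠ next d) :
    StrictMono fun j : Fin (k + 1) ↦ θ ((next ^ (j : ℕ)) (next d)) :=
  Fin.strictMono_iff_lt_succ.2 fun j ↦ by simpa using h.lt_of_wrap hd j (hk j j.isLt)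

end IsTraversalOrder

/-- **Satisfiability on two components.** Successor `(0 1)(2 3)` (the `next` of `hopfLink` in
`LinkKhResolutions`), components `0, 0, 1, 1`, parameters `1, 2, 4, 1/2`: wrap points `1` (base point
`0`) and `2` (base point `3`: `θ 3 = 1/2 < θ 2 = 4`), windows `[1, 2]`, `[1/2, 4]`. [folklore] -/
theorem isTraversalOrder_two_components :
    IsTraversalOrder (Equiv.swap (0 : Fin 4) 1 * Equiv.swap 2 3) ![(0 : Fin 2), 0, 1, 1]
      ![(1 : ℝ), 2, 4, 1 / 2] := by
  have hn : ⇑(Equiv.swap (0 : Fin 4) 1 * Equiv.swap 2 3 : Equiv.Perm (Fin 4)) = ![1, 0, 3, 2] := by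
    decide
  refine ⟨fun p ↦ ?_, ?_, fun p q _ ↦ ?_⟩
  · rw [hn]; fin_cases p <;> rfl
  · simp only [hn]
    intro p q
    fin_cases p <;> fin_cases q <;> simp <;> norm_num
  · have := Real.two_le_pi
    fin_cases p <;> fin_cases q <;> norm_num <;> linarith

/-! ## 2. Regular projections of links -/

/-- **A regular projection of the link `L` with a reading of its link Gauss diagram** (the link
analogue of `Knot.RegularProjection`). Data: the diagram; for each marked point `p` the component
`comp p : ι` on which the passage happens and its parameter `θ p` (a traversal order for
`diagram.next`, see `IsTraversalOrder`); the matching `freeComp` of the `free` chord-free circles of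
the diagram with the components of `L` carrying no passage. Conditions, for the stereographic plane
curves `γ_a = (L.component a).planeCurve` (Rolfsen (1976), §3.E; GPV (2000), §1): every component
misses the north pole and `γ_a` is an immersion; the two passages of chord `i` project to one point
(`double`); the listed passages are the only coincidences between all the `γ_a` on a period
(`eq_or_crossing` — in particular free components are embedded and meet no other component in
projection, and there are no triple points thanks to `bijective`); the over-passage is the higher one;
the sign of chord `i` is the orientation of `(γ'ₒ, γ'ᵤ)`, which also makes crossings transverse
(`det_ne_zero`). Consequence: `ι` is finite (`finite_index`). [cite: GPV2000, §1] -/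
structure LinkRegularProjection {ι : Type*} (L : Link ι) where
  /-- The link Gauss diagram read off the projection. -/
  diagram : LinkGaussDiagram
  /-- The component on which the passage through the marked point `p` happens. -/
  comp : Fin (2 * diagram.n) → ι
  /-- The parameter (on the component `comp p`) of the passage through the marked point `p`. -/
  θ : Fin (2 * diagram.n) → ℝ
  /-- Along `next` one stays on the component and the parameter increases, except at one wrap point
  per component; the parameters of a component lie in one period. -/
  traversal : IsTraversalOrder diagram.next comp θ
  /-- The chord-free circles of the diagram, as components of the link. -/
  freeComp : Fin diagram.free ↪ ι
  /-- The chord-free circles are exactly the components carrying no marked point. -/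
  range_freeComp : range freeComp = (range comp)ᶜ
  /-- Every component misses the centre of projection. -/
  northPole_notMem : ∀ a, northPole ∉ range (L.component a)
  /-- Every component projects to an immersed plane curve. -/
  deriv_ne_zero : ∀ a t, deriv (L.component a).planeCurve t ≠ 0
  /-- The two passages of chord `i` project to the same point. -/
  double : ∀ i, (L.component (comp (diagram.overPos i))).planeCurve (θ (diagram.overPos i)) =
    (L.component (comp (diagram.underPos i))).planeCurve (θ (diagram.underPos i))
  /-- The listed crossings are the only coincidences: if `γ_a s = γ_b t` then either `a = b` and
  `s ≡ t (mod 2π)`, or `{(a, s), (b, t)}` is, modulo `2π` in the second coordinates, the pair of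
  passages of some chord `i` (self-crossing if `comp (overPos i) = comp (underPos i)`, mutual
  crossing otherwise). -/
  eq_or_crossing : ∀ a b s t, (L.component a).planeCurve s = (L.component b).planeCurve t →
    (a = b ∧ ∃ k : ℤ, t = s + k * (2 * Real.pi)) ∨
      ∃ (i : Fin diagram.n) (k l : ℤ),
        ({(a, s + k * (2 * Real.pi)), (b, t + l * (2 * Real.pi))} : Set (ι × ℝ)) =
          {(comp (diagram.overPos i), θ (diagram.overPos i)),
            (comp (diagram.underPos i), θ (diagram.underPos i))}
  /-- At chord `i` the over-passage is higher than the under-passage. -/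
  heightCurve_lt : ∀ i,
    (L.component (comp (diagram.underPos i))).heightCurve (θ (diagram.underPos i)) <
      (L.component (comp (diagram.overPos i))).heightCurve (θ (diagram.overPos i))
  /-- The sign of chord `i` is the sign of `det (γ'ₒ, γ'ᵤ)` (right-handed crossings are positive;
  in particular the crossing is transverse). -/
  sign_eq : ∀ i, (diagram.sign i : ℤ) = SignType.sign (Matrix.det
    !![(deriv (L.component (comp (diagram.overPos i))).planeCurve (θ (diagram.overPos i))).1,
        (deriv (L.component (comp (diagram.overPos i))).planeCurve (θ (diagram.overPos i))).2;
       (deriv (L.component (comp (diagram.underPos i))).planeCurve (θ (diagram.underPos i))).1,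
        (deriv (L.component (comp (diagram.underPos i))).planeCurve (θ (diagram.underPos i))).2])

namespace LinkRegularProjection

variable {ι : Type*} {L : Link ι} (P : LinkRegularProjection L)

/-- Transversality: the determinant of the two velocities at a crossing is non-zero (its sign is
`±1`). [folklore] -/
theorem det_ne_zero (i : Fin P.diagram.n) : Matrix.det
    !![(deriv (L.component (P.comp (P.diagram.overPos i))).planeCurve
          (P.θ (P.diagram.overPos i))).1,
        (deriv (L.component (P.comp (P.diagram.overPos i))).planeCurve
          (P.θ (P.diagram.overPos i))).2;
       (deriv (L.component (P.comp (P.diagram.underPos i))).planeCurve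
          (P.θ (P.diagram.underPos i))).1,
        (deriv (L.component (P.comp (P.diagram.underPos i))).planeCurve
          (P.θ (P.diagram.underPos i))).2] ≠ 0 := by
  intro h
  have := P.sign_eq i
  rw [h, sign_zero] at this
  exact (P.diagram.sign i).ne_zero (by exact_mod_cast this)

/-- A component is chord-free iff it carries no marked point. [folklore] -/
theorem mem_range_freeComp_iff (a : ι) : a ∈ range P.freeComp ↔ ∀ p, P.comp p ≠ a := by
  rw [P.range_freeComp, mem_compl_iff, mem_range, not_exists]

include P in
/-- **The index type of a link with a regular projection is finite** (components with a passage are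
in the range of `comp`, the others in the range of `freeComp`). [folklore] -/
theorem finite_index : Finite ι := by
  have hu : (univ : Set ι) = range P.comp ∪ range P.freeComp := by
    rw [P.range_freeComp, union_compl_self]
  exact finite_univ_iff.1 (hu ▸ (finite_range _).union (finite_range _))

/-- The components named in a crossing carry marked points. [folklore] -/
theorem mem_range_comp_of_pair_eq {a b : ι} {s t : ℝ} {i : Fin P.diagram.n}
    (h : ({(a, s), (b, t)} : Set (ι × ℝ)) =
      {(P.comp (P.diagram.overPos i), P.θ (P.diagram.overPos i)),
        (P.comp (P.diagram.underPos i), P.θ (P.diagram.underPos i))}) : a ∈ range P.comp := by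
  have ha : (a, s) ∈ ({(P.comp (P.diagram.overPos i), P.θ (P.diagram.overPos i)),
      (P.comp (P.diagram.underPos i), P.θ (P.diagram.underPos i))} : Set (ι × ℝ)) :=
    h ▸ mem_insert _ _
  rcases ha with ha | ha
  · exact ⟨_, (congrArg Prod.fst ha).symm⟩
  · exact ⟨_, (congrArg Prod.fst (mem_singleton_iff.1 ha)).symm⟩

/-- **A chord-free component is embedded in projection**: its plane curve identifies only parameters
congruent modulo `2π`. [folklore] -/
theorem exists_int_of_free {a : ι} (ha : a ∉ range P.comp) {s t : ℝ}
    (hst : (L.component a).planeCurve s = (L.component a).planeCurve t) :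
    ∃ k : ℤ, t = s + k * (2 * Real.pi) := by
  rcases P.eq_or_crossing a a s t hst with ⟨-, h⟩ | ⟨i, k, l, h⟩
  · exact h
  · exact absurd (P.mem_range_comp_of_pair_eq h) ha

/-- **A chord-free component meets no other component in projection.** [folklore] -/
theorem planeCurve_ne_of_free {a b : ι} (ha : a ∉ range P.comp) (hab : a ≠ b) (s t : ℝ) :
    (L.component a).planeCurve s ≠ (L.component b).planeCurve t := fun hst ↦ by
  rcases P.eq_or_crossing a b s t hst with ⟨h, -⟩ | ⟨i, k, l, h⟩
  · exact hab h
  · exact ha (P.mem_range_comp_of_pair_eq h)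

end LinkRegularProjection

/-- The link `L` **has link Gauss diagram** `D` if some regular projection of `L` (stereographic, from
the north pole, with some numbering of the chords and of the marked points) reads `D`. As for knots
this is an honest predicate on the embedding, NOT invariant under isotopy of `L`. GPV (2000), §1.
[cite: GPV2000, §1] -/
def Link.HasGaussDiagram {ι : Type*} (L : Link ι) (D : LinkGaussDiagram) : Prop :=
  ∃ P : LinkRegularProjection L, P.diagram = D

/-! ## 3. Sanity: the knot tower specialises -/

/-- In coordinates `finRotate m` is `p ↦ (p + 1) % m`. [folklore] -/
theorem val_finRotate {m : ℕ} (p : Fin m) : ((finRotate m p : Fin m) : ℕ) = (p.val + 1) % m := by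
  cases m with
  | zero => exact p.elim0
  | succ m =>
    rw [coe_finRotate]
    split_ifs with h
    · rw [h, Fin.val_last, Nat.mod_self]
    · rw [Nat.mod_eq_of_lt (by have := Fin.val_lt_last h; omega)]

/-- Only the last point is not below its rotate. [folklore] -/
theorem val_add_one_eq_of_finRotate_le {m : ℕ} {p : Fin m} (h : finRotate m p ≤ p) :
    p.val + 1 = m := by
  rw [Fin.le_def, val_finRotate] at h
  rcases Nat.lt_or_ge (p.val + 1) m with h1 | h1
  · rw [Nat.mod_eq_of_lt h1] at h; omega
  · have := p.isLt; omega

/-- **The link diagram of a knot diagram, with the correct number of free circles**: as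
`LinkGaussDiagram.ofGaussDiagram` (`next = finRotate`), but a crossingless knot diagram is ONE free
circle. [folklore] -/
def ofKnotDiagram (G : GaussDiagram) : LinkGaussDiagram where
  n := G.n
  free := if G.n = 0 then 1 else 0
  overPos := G.overPos
  underPos := G.underPos
  sign := G.sign
  bijective := G.bijective
  next := finRotate (2 * G.n)

/-- With at least one chord, `ofKnotDiagram` is the embedding `ofGaussDiagram` of the knot tower.
[folklore] -/
theorem ofKnotDiagram_of_ne_zero {G : GaussDiagram} (h : G.n ≠ 0) :
    ofKnotDiagram G = LinkGaussDiagram.ofGaussDiagram G := by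
  simp only [ofKnotDiagram, LinkGaussDiagram.ofGaussDiagram, if_neg h]

/-- Without chords, `ofKnotDiagram` is the one-circle crossingless diagram `unknots 1`. [folklore] -/
theorem ofKnotDiagram_of_eq_zero {G : GaussDiagram} (h : G.n = 0) :
    ofKnotDiagram G = LinkGaussDiagram.unknots 1 := by
  obtain ⟨n, o, u, s, b⟩ := G
  change n = 0 at h
  subst h
  simp only [ofKnotDiagram, LinkGaussDiagram.unknots, if_true, LinkGaussDiagram.mk.injEq,
    heq_eq_eq, true_and]
  exact ⟨funext fun i ↦ i.elim0, funext fun i ↦ i.elim0, funext fun i ↦ i.elim0,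
    Equiv.ext fun i ↦ i.elim0⟩

/-- **Sanity: a regular projection of a knot is a regular projection of its one-component link**
`Link.ofKnot K`, reading `ofKnotDiagram P.diagram`: `comp` is constant, `θ` is the knot's `θ`, the
traversal order comes from `strictMono`/`lt_add_two_pi` (wrap point `2n - 1`), the free circle (if
`n = 0`) is the unique component, and each geometric clause is the knot clause. [folklore] -/
def LinkRegularProjection.ofKnot {K : Knot} (P : K.RegularProjection) :
    LinkRegularProjection (Link.ofKnot K) where
  diagram := ofKnotDiagram P.diagram
  comp _ := ()
  θ := P.θ
  traversal :=
    { comp_next := fun _ ↦ rfl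
      wrap_unique := fun p q _ hp hq ↦ Fin.ext <| by
        have h1 := val_add_one_eq_of_finRotate_le (P.strictMono.le_iff_le.1 hp)
        have h2 := val_add_one_eq_of_finRotate_le (P.strictMono.le_iff_le.1 hq)
        omega
      lt_add_two_pi := fun p q _ ↦ P.lt_add_two_pi p q }
  freeComp := ⟨fun _ ↦ (), fun i j _ ↦ by
    have : (ofKnotDiagram P.diagram).free ≤ 1 := by
      change (if P.diagram.n = 0 then 1 else 0) ≤ 1; split <;> omega
    exact (Fin.subsingleton_iff_le_one.2 this).elim i j⟩
  range_freeComp := by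
    ext a
    simp only [mem_range, mem_compl_iff, exists_const_iff, and_true]
    rw [← Fin.pos_iff_nonempty, ← Fin.pos_iff_nonempty]
    change (0 < if P.diagram.n = 0 then 1 else 0) ↔ ¬ 0 < 2 * P.diagram.n
    split <;> omega
  northPole_notMem _ := P.northPole_notMem
  deriv_ne_zero _ := P.deriv_ne_zero
  double := P.double
  eq_or_crossing a b s t hst := by
    rcases P.eq_or_crossing s t hst with h | ⟨i, k, l, h⟩
    · exact Or.inl ⟨Subsingleton.elim a b, h⟩
    · refine Or.inr ⟨i, k, l, ?_⟩
      rcases pair_eq_pair_iff.1 h with ⟨h1, h2⟩ | ⟨h1, h2⟩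
      · exact pair_eq_pair_iff.2 (Or.inl ⟨Prod.ext (Subsingleton.elim _ _) h1,
          Prod.ext (Subsingleton.elim _ _) h2⟩)
      · exact pair_eq_pair_iff.2 (Or.inr ⟨Prod.ext (Subsingleton.elim _ _) h1,
          Prod.ext (Subsingleton.elim _ _) h2⟩)
  heightCurve_lt := P.heightCurve_lt
  sign_eq := P.sign_eq

/-- **A knot with Gauss diagram `G` is a one-component link with link Gauss diagram
`ofKnotDiagram G`.** [folklore] -/
theorem hasGaussDiagram_ofKnot {K : Knot} {G : GaussDiagram} (h : K.HasGaussDiagram G) :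
    Link.HasGaussDiagram (Link.ofKnot K) (ofKnotDiagram G) := by
  obtain ⟨P, rfl⟩ := h
  exact ⟨LinkRegularProjection.ofKnot P, rfl⟩

/-- With at least one crossing the link diagram of `Link.ofKnot K` is `ofGaussDiagram G`, the image of
the knot tower on which `LinkKhResolutions` agrees with `KhResolutions`. [folklore] -/
theorem hasGaussDiagram_ofKnot_of_ne_zero {K : Knot} {G : GaussDiagram} (h : K.HasGaussDiagram G)
    (hn : G.n ≠ 0) : Link.HasGaussDiagram (Link.ofKnot K) (LinkGaussDiagram.ofGaussDiagram G) :=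
  ofKnotDiagram_of_ne_zero hn ▸ hasGaussDiagram_ofKnot h

/-- A crossingless knot projection reads the one-circle diagram `unknots 1` (not
`ofGaussDiagram GaussDiagram.empty = unknots 0`). [folklore] -/
theorem hasGaussDiagram_ofKnot_of_eq_zero {K : Knot} {G : GaussDiagram} (h : K.HasGaussDiagram G)
    (hn : G.n = 0) : Link.HasGaussDiagram (Link.ofKnot K) (LinkGaussDiagram.unknots 1) :=
  ofKnotDiagram_of_eq_zero hn ▸ hasGaussDiagram_ofKnot h

/-! ## 4. The input of the next file: checkerboard colourings -/

/-- **Checkerboard colouring** of a link Gauss diagram: a `ZMod 2`-colouring of the marked points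
that changes along every arc and across every chord (equivalently: a choice of over/under making the
diagram alternating; Kamada (2002)). On a knot diagram, position parity is one iff every chord is
even (Gauss's condition). This — not evenness chord by chord, meaningless without a base point per
component — is what the walk of `KhResolutionsDichotomyProofs` consumes. [cite: Kamada2002] -/
structure IsCheckerboard (D : LinkGaussDiagram) (c : Fin (2 * D.n) → ZMod 2) : Prop where
  /-- The colour changes along every arc. -/
  next_flip : ∀ p, c (D.next p) = c p + 1
  /-- The colour changes across every chord. -/
  chord_flip : ∀ i, c (D.underPos i) = c (D.overPos i) + 1

/-- **Gauss's condition is checkerboard colourability by position parity**: if every chord of `G`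
joins positions of opposite parity (`Knot.RegularProjection.overPos_mod_two_ne_underPos_mod_two`,
`RegularProjectionParity`; Kauffman (1999), §3.2, Lemma 1), then `p ↦ p mod 2` is a checkerboard
colouring of `ofGaussDiagram G`. [folklore] -/
theorem isCheckerboard_ofGaussDiagram {G : GaussDiagram}
    (hG : ∀ j, (G.overPos j : ℕ) % 2 ≠ (G.underPos j : ℕ) % 2) :
    IsCheckerboard (LinkGaussDiagram.ofGaussDiagram G) fun p ↦ ((p : ℕ) : ZMod 2) where
  next_flip p := by
    change (((finRotate (2 * G.n) p : Fin _) : ℕ) : ZMod 2) = ((p : ℕ) : ZMod 2) + 1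
    rw [val_finRotate, ← Nat.cast_succ, ZMod.natCast_eq_natCast_iff',
      Nat.mod_mod_of_dvd _ (dvd_mul_right 2 G.n)]
  chord_flip i := by
    change ((G.underPos i : ℕ) : ZMod 2) = ((G.overPos i : ℕ) : ZMod 2) + 1
    rw [← Nat.cast_succ, ZMod.natCast_eq_natCast_iff']
    have := hG i
    omega

/-- **A checkerboard-colourable diagram has an even number of chord ends on every component**
(the colour alternates around the cycle of `p` and returns to its value). [folklore] -/
theorem IsCheckerboard.even_minimalPeriod {D : LinkGaussDiagram} {c : Fin (2 * D.n) → ZMod 2}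
    (h : IsCheckerboard D c) (p : Fin (2 * D.n)) : Even (minimalPeriod D.next p) := by
  have hk : ∀ k, c (D.next^[k] p) = c p + k := by
    intro k
    induction k with
    | zero => simp
    | succ k ih => rw [iterate_succ_apply', h.next_flip, ih, Nat.cast_succ, add_assoc]
  have := hk (minimalPeriod D.next p)
  rw [iterate_minimalPeriod, left_eq_add] at this
  exact (ZMod.natCast_eq_zero_iff_even).1 this

end Summit.SmoothPoincare4.SmoothPoincare4.Cruxes.ZseThesis.Design

end
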